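import Mathlib
import HarnessLib
import HarnessLib.Audit
import Summits.PneNP.Statement
import Literature.Computability.MetaComplexity.NCIPS
import Literature.Computability.MetaComplexity.Frege
import Literature.Computability.Complexity.CNF

/-!
Route: CnfIdealGenLength

DORMANT since 2026-09-03T20:06:56Z (reconciler: no traction for 5 d (last activity item-evidence-added at 2026-08-29T19:30:44Z); parked, not closed — `ledger route dormant route-PneNP-CnfIdealGenLength --off` to reactivate) — unstaffed, not closed; items shared with open routes are served there. `ledger route dormant <id> --off` reactivates.

# Route CnfIdealGenLength — Frege lower bounds as area — superpolynomial two-sided generation length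
of the clause product in the free algebra, wired to P ≠ NP by the Frege collapse bridge

It suffices to show X = GL ∧ Sh ∧ CRF over the landed vocabulary
`Literature.Computability.MetaComplexity.NCIPS` (clause words,
the clause product `clauseProduct R φ = Π_κ (1 − Q_κ)` in `MonoidAlgebra R (FreeMonoid ν)` = R⟨x⟩,
Boolean/commutator axioms `IsAxiom`,
bounded two-sided representations `HasBoundedRepr R E r φ` = "P_φ = Σ_(ρ<r) u_ρ g_ρ v_ρ with axioms
g_ρ and word-degrees of u_ρ, v_ρ ≤ E")
and the tree's Frege vocabulary. (GL, deciding, = the 2001 wall W_GL) some polynomial-size family of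
UNSATISFIABLE CNFs φ_n over
x_0..x_(n−1) has, for every c and all large n, NO representation of `clauseProduct ℚ (φ n)` with <
n^c terms of degree ≤ n^c
(superpolynomial generation length λ^(n^c)); (Sh) every polynomially bounded Frege system forces
polynomial generation length on every
such family (Li–Tzameret–Wang Thm 1.4 + flattening of non-commutative formula certificates); (CRF,
declared residual, S-implied)
P = NP ⇒ some Frege system is polynomially bounded. Realises the markdown-first sketch
cnf-ideal-generation-length (reader PASS).
Lean: `(∃ p : Polynomial ℕ, ∃ φ : (n : ℕ) → Literature.Computability.Complexity.CNF (Fin n), (∀ n, ¬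
(φ n).Satisfiable ∧ Literature.Computability.Complexity.CNF.numClauses (φ n) ≤ p.eval n ∧
Literature.Computability.Complexity.CNF.size (φ n) ≤ p.eval n) ∧ ∀ c : ℕ, ∀ᶠ n in Filter.atTop, ¬
Literature.Computability.MetaComplexity.NCIPS.HasBoundedRepr ℚ (n ^ c) (n ^ c) (φ n)) ∧ (∀ F :
Literature.Computability.MetaComplexity.FregeSystem, Literature.Computability.MetaComplexity.IsFrege
F → F.IsPolyBounded → ∀ (p : Polynomial ℕ) (φ : (n : ℕ) → Literature.Computability.Complexity.CNF
(Fin n)), (∀ n, ¬ (φ n).Satisfiable ∧ Literature.Computability.Complexity.CNF.numClauses (φ n) ≤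
p.eval n ∧ Literature.Computability.Complexity.CNF.size (φ n) ≤ p.eval n) → ∃ c : ℕ, ∀ᶠ n in
Filter.atTop, Literature.Computability.MetaComplexity.NCIPS.HasBoundedRepr ℚ (n ^ c) (n ^ c) (φ n))
∧ (¬ PneNP → ∃ F : Literature.Computability.MetaComplexity.FregeSystem,
Literature.Computability.MetaComplexity.IsFrege F ∧ F.IsPolyBounded)`

## Assembly
Pure filter logic, kernel-checked in glue.lean (`closes`, 6 lines): assume ¬PneNP; CRF gives a
polynomially bounded Frege system F; Sh applied to F
and to GL's family φ gives c with `∀ᶠ n, HasBoundedRepr ℚ (n^c) (n^c) (φ n)`; GL at the same c gives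
`∀ᶠ n, ¬ HasBoundedRepr …`; the conjunction is
eventually False on `atTop ≠ ⊥`. All three binders are consumed (BC1 cone = 3). The attack on GL is
its registered skeleton (Lines/birth.lean):
`stub_rdr` (W_RDR, rank-defect representations = phantom satisfying subspaces), `stub_rankCount`
(rank P_φ(M) ≤ r·max rank g(M) for an evaluated
representation), `stub_reprBaseChange` (ℚ-representations extend to char-0 fields) with
`GenLengthSuperpoly_of` PROVED (Sketch.lean
`GenLengthSuperpoly_of_rdr`); W_RDR is added as the rank-3 crux item right after birth so that it
enters the cone as a named stub (BC6).

Rationale: WHY THIS LINE. Mechanism: by LiTzameretWang2018 (= arXiv:1412.8746, Thm 1.4) Frege is p-simulated by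
the non-commutative formula IPS over ℚ, and cutting a
non-commutative formula certificate at its placeholder leaves and rank-factorising its flattenings
turns a certificate of formula size s for the
CNF φ into a two-sided representation of ONE explicit element, the clause product P_φ, by poly(s)
single terms u·g·v modulo the Boolean and commutator
axioms (a Gröbner–Shirshov basis of ℚ⟨x⟩ → ℚ^(2^n)); so a superpolynomial lower bound on this
COEFFICIENT-BLIND generation length ("area" of P_φ; for
char ≠ 2 literally an area in the group ring ℚ[(ℤ/2)^(*n)] of the universal Coxeter group relative
to the square relators of the n-cube) is a Frege
lower bound, and the Frege-level collapse bridge (the theory-swapped form of Pich–Santhanam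
doi:10.1145/3801091 Thm 19/Cor 20, one proof system below the
hub item CollapseReachesEF) carries it to P ≠ NP. Imported areas: non-commutative algebraic
complexity (Nisan 1991 flattening ranks; rank-method barriers
arXiv:1710.09502, arXiv:1904.04299), free ideal rings (Cohn 1971 §2.5, Schreier–Lewin bases),
rank-metric stability of almost-representations
(arXiv:2401.04676, arXiv:1708.05338) for the attack crux, and combinatorial group theory (Dehn
functions; Krajíček 2003 "Dehn function and length of
proofs" is the nearest printed use of area in proof complexity, for word problems encoding proof
systems, not for a natural element of a group ring).
What it does that prior routes do not: it is the first hub route in which a Frege-strength lower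
bound is LOAD-BEARING (Proofcplx/ProofCplx carry
Frege-LB only as an unstaffed rung; FeasibleWitnessing/FreeHardnessEF sit at EF with no lower-bound
mechanism), through a new typed object absent from all
59 PneNP theses, 171 cards and 6 negatives.

RANKED CRUXES. #2 GenLengthSuperpoly (crux) — W_GL (2001 wall, as minted): there are a polynomial p
and unsatisfiable CNFs φ_n in the variables x_0..x_(n−1) with numClauses and size ≤ p(n) such that
for every c, eventually in n, `clauseProduct ℚ (φ n)` has NO two-sided representation Σ_(ρ<n^c) u_ρ
g_ρ v_ρ with g_ρ Boolean/commutator axioms and wordDeg u_ρ, wordDeg v_ρ ≤ n^c. The unsatisfiability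
and the size bound are mandatory conjuncts (else vacuous: λ = ∞ on satisfiable φ; exponential-width
clauses). [difficulty: open-problem] (why it might fail: ¬W_GL (2001 OPEN 7.4): every unsatisfiable
CNF may admit n^O(1) wild finitely supported cofactors — the I-adic completion already has an
O(w²m²)-term representation and every tested quotient (I-adic, cofinite, GNS, decision-list) is
fooled by fakes.) [LiTzameretWang2018, arXiv:1412.8746, arXiv:1607.00443, arXiv:1710.09502,
arXiv:2401.04676, 2001-archive:pnp/routes/frege-via-noncommutative-ips-rank/work/WALL-REQUEST-4e.md]
#4 CollapseReachesFrege (crux) — the Frege-level collapse bridge (DECLARED RESIDUAL, implied by S):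
if P = NP then some Frege system is polynomially bounded — the Frege form of Pich–Santhanam's Open
Problem 1 (their Thm 19/Cor 20 are the EF-level theorems); it implies the hub item CollapseReachesEF
(stmt-PneNP-17354) via `IsPolyBounded.isEFPolyBounded` and differs from it exactly in
`IsPolyBounded` vs `IsEFPolyBounded`. [difficulty: open-problem] (why it might fail: P = NP may hold
via an algorithm whose correctness has no feasible NC¹-reasoning (Frege-translatable) proofs; even
the EF version is open (Cook–Krajíček: optimal systems may need advice), and Frege may be strictly
weaker than EF.) [doi:10.1145/3801091, arXiv:2312.08163,
book:cook2010-logical-foundations-proof-complexity, hub:stmt-PneNP-17354]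
#5 FregeShortensGenLength (crux) — for every Frege system F with IsFrege F and F.IsPolyBounded,
every polynomial p and every family of unsatisfiable CNFs φ_n over x_0..x_(n−1) with numClauses,
size ≤ p(n): ∃ c, eventually `HasBoundedRepr ℚ (n^c) (n^c) (φ n)`. Chain: ¬φ_n are DNF tautologies
of size poly(n) ⇒ poly-size F-proofs ⇒ (LTW Thm 1.4) poly-size non-commutative formula IPS
certificates over ℚ ⇒ (first-placeholder cut + rank factorisation of the flattening, 2001 results
Prop 1.1/Lemma 1.3/Prop 7.2) ≤ poly single terms of poly degree. Known modulo write-up; a crux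
because LTW Thm 1.4 needs ≈ 300 lines of NC-formula/IPS syntax as a named Literature fact and the
flattening half is unpublished-internal. [difficulty: L] (why it might fail: mathematically only via
an error in LTW Thm 1.4 or in the elementary flattening lemmas; the live risks are cost (NC-IPS
syntax must land in Literature first) and a polarity/ordering mismatch between the tree's
CNF→PropForm translation and LTW's tr.) [LiTzameretWang2018, arXiv:1412.8746, arXiv:1910.08503,
book:krajicek1995-bounded-arithmetic-propositional-logic-complexity-theory]

TWO-LAYER PLAN. Foreseen, nothing filed now beyond the post-birth rank-3 item
RankDefectRepresentations (Lean: `∃ p : Polynomial ℕ, ∃ φ : (n : ℕ) →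
Literature.Computability.Complexity.CNF (Fin n), (∀ n, ¬ (φ n).Satisfiable ∧
Literature.Computability.Complexity.CNF.numClauses (φ n) ≤ p.eval n ∧
Literature.Computability.Complexity.CNF.size (φ n) ≤ p.eval n) ∧ ∀ c : ℕ, ∀ᶠ n in Filter.atTop, ∃ (K
: Type) (_ : Field K) (_ : CharZero K) (d t : ℕ) (M : Fin n → Matrix (Fin d) (Fin d) K), (∀ g :
MonoidAlgebra K (FreeMonoid (Fin n)), Literature.Computability.MetaComplexity.NCIPS.IsAxiom g →
(MonoidAlgebra.lift K (Matrix (Fin d) (Fin d) K) (FreeMonoid (Fin n)) (FreeMonoid.lift M) g).rank ≤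
t) ∧ n ^ c * t < (MonoidAlgebra.lift K (Matrix (Fin d) (Fin d) K) (FreeMonoid (Fin n))
(FreeMonoid.lift M) (Literature.Computability.MetaComplexity.NCIPS.clauseProduct K (φ n))).rank` —
the registered skeleton's first stub; why it
might fail: commuting Boolean tuples may be POLYNOMIALLY rank-stable at every fixed defect rank,
ST-poly(k), proved at k = 1 modulo a finite check by the
2001 + seat; sources arXiv:2401.04676, arXiv:1708.05338, arXiv:1811.09585). After a crux closes or a
line dies, split GenLengthSuperpoly by METHOD (k ≤ 3):
(2a) the representation line = RankDefectRepresentations → RankCount → ReprBaseChange →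
GenLengthSuperpoly (glue already proved); (2b) the fir line —
a valuation / inner-rank invariant on the free right ideal I_n = ⊕ e·ℚ⟨x⟩ (Schreier–Lewin
coordinates of P_φ) sub-additive on single terms and large on
P_φ; (2c) the filling line — a filling inequality for group-ring 2-chains with
ℚ[(ℤ/2)^(*n)]-coefficients exceeding the homological filling. Birth skeletons (BC3, all rc 0 with
sorries = stubs, registered as Lines/birth.lean after open): RankDefectRepresentations ←
`stub_ncModels` (exact nc-models: idempotents killing every ordered clause word, commutator rank t
with d/t superpolynomial — paper v10 Prop. prop:matrix special case) + `stub_modelsGiveDefect`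
(evaluation: axioms ↦ rank ≤ t, P_φ ↦ 1); CollapseReachesFrege ← `stub_searchSATOfCollapse` (=
shared item FeasibleWitnessing.SearchSATOfCollapse, stmt-PneNP-17356, by name) +
`stub_fregeFromSolver` (a poly-time search-SAT function ⇒ a p-bounded Frege system: the residual
proper, Cook 1975 / Pich–Santhanam feasible provability of the solver); FregeShortensGenLength ←
`stub_fregeToNCF` (LTW Thm 1.4 over a minimal local NC-formula syntax `NCF` with `NCFRefutable s n
φ`) + `stub_ncfToRepr` (flattening, 2001 Prop 1.1/Lemma 1.3/Prop 7.2), with the polynomial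
bookkeeping proved. Later split of
CollapseReachesFrege as Pich–Santhanam do: ProvableWitnessingNC1 → CollapseReachesFrege plus the
witnessing hypothesis.

KILL CRITERIA. NegGenLength (¬GenLengthSuperpoly: for every poly-size unsatisfiable family some c
has λ^(n^c)(φ_n) ≤ n^c infinitely often) proved ⇒ `close --reason
refuted:GenLengthSuperpoly` and the theorem is banked as a barrier for the whole coefficient-blind
axis of the LTW programme. ST-poly(k) for all k or the
polynomial total-rank-defect inequality proved ⇒ RankDefectRepresentations refuted-substantive ⇒
drop the representation line, GenLengthSuperpoly stays
on lines 2b/2c. CollapseReachesFrege refuted (relativisation cannot do it; it is S-implied, so a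
refutation proves P ≠ NP) — no kill. A proof elsewhere
of `∀ F, IsFrege F → ¬ F.IsPolyBounded` (hub rung ProofcplxFregeLb) moots GL ∧ Sh but not the route
(CRF still needed); a proof of CollapseReachesEF +
EFLowerBound (FeasibleWitnessing) moots everything.

NOT DECOMPOSED YET. The NC-formula-IPS middle of FregeShortensGenLength as ITEMS (5a
FregeGivesSmallNCIPS = LTW Thm 1.4 as a cite-tagged Literature fact, 5b NCIPSGivesShortRepr = the
flattening half) — the birth skeleton types both over a 40-line local syntax `NCF`; promoting them
to items waits for the Literature-grade NC-formula file; the sub-walls of RankDefectRepresentations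
(instability at fixed
defect rank k ≥ 2 for irreducible tuples; a CNF family threading it; finrank of the P_φ-fixed
subspace vs rank); constants (the factor 9 + (mw)² between
λ and the pure commutator length; |B_n| = n + C(n,2)); the group-ring dictionary ℚ⟨x⟩/(x_i² − x_i)
≃ₐ ℚ[(ℤ/2)^(*n)] (needed by line 2c only). All are
layer-2 children or prover-side `--supports` lemmas.

CHEAPEST FALSIFIER. A refuter constructs, for ALL unsatisfiable CNFs, n^O(1)-term representations of
P_φ from its Schreier–Lewin coordinates in the free right ideal I_n with
cancellation across basis elements (2001 WALL-REQUEST-4e lens (6)) — that proves NegGenLength.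
Second cheapest (one kit batch, not run by this seat): exact
λ^(E) over ℤ_3 by SAT/ILP on the 2001 folder's n ≤ 4 instances against the O(w²m²) quasi-idempotency
prediction; uninformative asymptotically but it
calibrates the definitions. Lookup run by this seat: `ledger negatives --problem PneNP` (6 entries,
none on IPS / generation length / Frege bounds).

NUMBERS. |B_n| = n + n(n−1)/2 axioms; universal upper bound λ(φ) ≤ n((n−1)2^n + 1) (I_n is a free
right ideal of rank (n−1)2^n + 1, Lewin–Schreier); quasi-
idempotency: P_φ² − P_φ is a sum of ≤ (mw)²/2 + mw/2 single terms (2001 Thm 10.1), so every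
invariant factoring through ℚ⟨x⟩/I_n^(t+1) certifies only
O(w²m²); GNS/moment modules cap at λ = O(√n) (2001 Prop 10.3); rank-stability modulus of the
Boolean/commutator presentation 2^O(n)·t (arXiv:2401.04676 Thm
5.1 as specialised in 2001 Prop 8.7); LTW: Frege proof of size s ⇒ NC-formula IPS certificate of
size poly(s) over ℚ or ℤ_q (Thm 1.4); converse
quasi-polynomial over GF(2) (Thm 1.7).

DEFINITION REQUESTS. None outstanding: the statement-level vocabulary landed as
`Literature/Computability/MetaComplexity/NCIPS.lean` (p171527: X, litWord, clauseWord,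
clauseProduct, IsAxiom, wordDeg, HasBoundedRepr, boolEval, HasBoundedRepr.not_satisfiable; cites
LiTzameretWang2018 Def 1.2/1.3/1.6). Wanted later by the
prover of FregeShortensGenLength (not by any statement): non-commutative formulas + NC-IPS
certificates (LTW Def 1.2) and LTW Thm 1.4 as a cite-tagged
named fact; the CNF → PropForm (¬φ as a DNF tautology) link next to `CNF.IsDNFTautology`.

Novelty: Searches (2026-08-17): lit search --hybrid `"non-commutative" "ideal proof system" Frege` (10 docs:
Krajíček 1995/2019, Cook–Nguyen, PT16 survey ×2 — context only; Krajíček 2019 §7.5.3 p.149–150 +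
p.156 surfaces Krajíček 2003 Dehn-function/length-of-proofs and Tzameret 2011 NC formulas); lit
search --source local `"rank methods" barrier lower bounds` (8: arXiv:1710.09502 pp 2,5,7;
arXiv:1904.04299 pp 2,3,5; arXiv:1701.05328; arXiv:2602.11309); lit vsearch "minimal number of
summands u g v … two-sided ideal of the free associative algebra … lower bounds" (8 generic algebra
books: Li 2011 Gröbner bases in ring theory p.68, Cox–Little–O'Shea, Greuel–Pfister — no length
invariant); lit galaxy search --star all "non-commutative IPS|noncommutative IPS|non-commutative
ideal proof system" (2: galaxy:pdf:1963389724818544740, galaxy:pdf:-5175624630350321980 = PT16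
survey); --star all "rank stability|stability in rank|almost commuting idempotent|Dehn function and
length of proofs" (20 rows, all noise); --star all "Dehn function and length of proofs|group-based
proof system|barriers for rank methods" (6: galaxy:panama:215590178390025 Krajíček Proof Complexity;
galaxy:pdf:1880639744558322880 Cavagnetto 2008 thesis, rewriting/van Kampen for Resolution;
galaxy:pdf:1192603100, galaxy:pdf:4854598660 citing EGOW); ledger negatives --problem PneNP (6, none
related); hub Theses/cards per the sketch's grep (IPS only as context in
Proofcplx/PrimalityPlaces/ChoicelessCapture/UncheckableSAT).
Neares  [refs: 1710.09502, 1904.04299, 1701.05328, 2602.11309, 1412.8746, book:krajind-proof-complexity, LiTzameretWang2018]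

Barriers (technique_class: algebraic-proof-complexity, generation-length, rank-stability): - technique_class: algebraic-proof-complexity, generation-length, rank-stability
- Literature.Barriers.PneNP.FeasibleInterpolationEF: outside — no interpolant or automatization is
extracted; the bound concerns representations of one fixed explicit element, and Frege is not known
to have feasible interpolation anyway (it fails under cryptographic assumptions, BPR00), so
interpolation-type barriers do not quantify over GL.
- Literature.Barriers.PneNP.NaturalProofs: not applicable as typed — GL is a statement about ONE
explicit element of a finitely presented algebra, not a constructive/large property of Boolean
functions; no theorem makes Razborov–Rudich bear on Frege-size lower bounds (noted, not claimed as
an escape for the eventual proof technique).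
- Literature.Barriers.PneNP.Relativization: not applicable — no oracle machines occur; CRF is
S-implied and GL/Sh are algebraic/proof-theoretic statements that do not relativise as typed.
- Literature.Barriers.PneNP.Algebrization: not applicable for the same reason; the route's algebra
is the free associative algebra of the proof system, not an algebraic oracle extension.
- Rank-method barriers (arXiv:1710.09502, arXiv:1904.04299; 2001 Thm 10.1 quasi-idempotency, Prop
10.3 GNS cap, Prop 10.4, Thm 13.5 / ST-poly(1)): INSIDE for every linear / flattening sub-method of
GL — each certifies λ ≤ poly; the escape is DECLARED: superpolynomial rank-INSTABILITY at fixed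
defect rank (the post-birth crux RankDefectRepresentations, GL's regis

History (route lifecycle, newest last):
- 2026-09-03T20:06:56Z · DORMANT — reconciler: no traction for 5 d (last activity item-evidence-added at 2026-08-29T19:30:44Z); parked, not closed — `ledger route dormant route-PneNP-CnfIdealGenL (operator:999:486423)

sub-problem: PneNP · status: dormant · opened planner-type-4883f19d1a-0 2026-08-17T18:00:03Z · rev 2 · ledger route-PneNP-CnfIdealGenLength
GENERATED by the gate from the ledger (D-0016/17). Provers cite these decls: `theorem foo : Summit.PneNP.PneNP.Theses.CnfIdealGenLength.<Decl> := …` in Summits/PneNP/PneNP/Theorems/<Name>.lean.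
-/

namespace Summit.PneNP.PneNP.Theses.CnfIdealGenLength

open scoped BigOperators Topology Manifold Classical MeasureTheory ProbabilityTheory Matrix InnerProductSpace ComplexConjugate ContinuousMap
open Filter Set Function TopologicalSpace MeasureTheory

attribute [summit_statement] _root_.PneNP

open Literature.PNP

/-- item stmt-PneNP-18879 · crux · rank 2 · open · by planner
why it might fail: ¬W_GL (2001 OPEN 7.4): every unsatisfiable CNF may admit n^O(1) wild finitely supported cofactors — the I-adic completion already has an O(w²m²)-term representation and every tested quotient (I-adic, cofinite, GNS, decision-list) is fooled by fakes.
sources: LiTzameretWang2018, arXiv:1412.8746, arXiv:1607.00443, arXiv:1710.09502, arXiv:2401.04676, 2001-archive:pnp/routes/frege-via-noncommutative-ips-rank/work/WALL-REQUEST-4e.md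
[crux] W_GL (2001 wall, as minted): there are a polynomial p and unsatisfiable CNFs φ_n in the
variables x_0..x_(n−1) with numClauses and size ≤ p(n) such that for every c, eventually in n,
`clauseProduct ℚ (φ n)` has NO two-sided representation Σ_(ρ<n^c) u_ρ g_ρ v_ρ with g_ρ
Boolean/commutator axioms and wordDeg u_ρ, wordDeg v_ρ ≤ n^c. The unsatisfiability and the size
bound are mandatory conjuncts (else vacuous: λ = ∞ on satisfiable φ; exponential-width clauses).
[difficulty: open-problem] -/
@[route_item "route-PneNP-CnfIdealGenLength"]
def GenLengthSuperpoly : Prop :=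
  ∃ p : Polynomial ℕ, ∃ φ : (n : ℕ) → Literature.Computability.Complexity.CNF (Fin n), (∀ n, ¬ (φ n).Satisfiable ∧ Literature.Computability.Complexity.CNF.numClauses (φ n) ≤ p.eval n ∧ Literature.Computability.Complexity.CNF.size (φ n) ≤ p.eval n) ∧ ∀ c : ℕ, ∀ᶠ n in Filter.atTop, ¬ Literature.Computability.MetaComplexity.NCIPS.HasBoundedRepr ℚ (n ^ c) (n ^ c) (φ n)

/-- item stmt-PneNP-18885 · crux · rank 4 · open · by planner
why it might fail: P = NP may hold via an algorithm whose correctness has no feasible NC¹-reasoning (Frege-translatable) proofs; even the EF version is open (Cook–Krajíček: optimal systems may need advice), and Frege may be strictly weaker than EF.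
sources: doi:10.1145/3801091, arXiv:2312.08163, book:cook2010-logical-foundations-proof-complexity, hub:stmt-PneNP-17354
[crux] the Frege-level collapse bridge (DECLARED RESIDUAL, implied by S): if P = NP then some Frege
system is polynomially bounded — the Frege form of Pich–Santhanam's Open Problem 1 (their Thm 19/Cor
20 are the EF-level theorems); it implies the hub item CollapseReachesEF (stmt-PneNP-17354) via
`IsPolyBounded.isEFPolyBounded` and differs from it exactly in `IsPolyBounded` vs `IsEFPolyBounded`.
[difficulty: open-problem] -/
@[route_item "route-PneNP-CnfIdealGenLength"]
def CollapseReachesFrege : Prop :=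
  ¬ PneNP → ∃ F : Literature.Computability.MetaComplexity.FregeSystem, Literature.Computability.MetaComplexity.IsFrege F ∧ F.IsPolyBounded

/-- item stmt-PneNP-18923 · support · rank 3 · open · by planner
why it might fail: commuting Boolean tuples may be POLYNOMIALLY rank-stable at every fixed defect rank (ST-poly(k); k = 1 proved modulo a finite check by the 2001 programme), or the polynomial total-rank-defect inequality W_TD holds — either refutes it.
sources: arXiv:2401.04676, arXiv:1708.05338, arXiv:1811.09585, LiTzameretWang2018, 2001-archive:pnp/routes/frege-via-noncommutative-ips-rank/work/WALL-REQUEST-4e.md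
[crux] W_RDR rank-defect representations (the SUFFICIENT door of GenLengthSuperpoly; = stub_rdr of
its registered skeleton Lines/birth.lean, so in-cone by BC6): some unsatisfiable polynomial-size CNF
family phi_n admits, for every c and all large n, a matrix tuple M over a field of characteristic 0
under which every Boolean/commutator axiom has rank <= t while the clause product P_phi has rank >
n^c * t (equivalently, Thm 32.3: an almost-representation with a phantom P_phi-fixed subspace of
dimension n^omega(1) * t; refereed special case: exact nc-models, paper v10 Prop. prop:matrix /
Remark 4). With RankCount + ReprBaseChange it gives GenLengthSuperpoly (GenLengthSuperpoly_of,
proved). Why it might fail: commuting Boolean tuples may be POLYNOMIALLY rank-stable at every fixed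
defect rank (ST-poly(k); k = 1 proved modulo a finite check by the 2001 + seat), or the polynomial
total-rank-defect inequality W_TD holds - either refutes it. Sources: arXiv:2401.04676 (Thm 5.1),
arXiv:1708.05338, arXiv:1811.09585, LiTzameretWang2018, 2001 archive WALL-REQUEST-4e K5 / results
Prop 8.1, 8.7. -/
@[route_item "route-PneNP-CnfIdealGenLength"]
def RankDefectRepresentations : Prop :=
  ∃ p : Polynomial ℕ, ∃ φ : (n : ℕ) → Literature.Computability.Complexity.CNF (Fin n), (∀ n, ¬ (φ n).Satisfiable ∧ Literature.Computability.Complexity.CNF.numClauses (φ n) ≤ p.eval n ∧ Literature.Computability.Complexity.CNF.size (φ n) ≤ p.eval n) ∧ ∀ c : ℕ, ∀ᶠ n in Filter.atTop, ∃ (K : Type) (_ : Field K) (_ : CharZero K) (d t : ℕ) (M : Fin n → Matrix (Fin d) (Fin d) K), (∀ g : MonoidAlgebra K (FreeMonoid (Fin n)), Literature.Computability.MetaComplexity.NCIPS.IsAxiom g → (MonoidAlgebra.lift K (Matrix (Fin d) (Fin d) K) (FreeMonoid (Fin n)) (FreeMonoid.lift M) g).rank ≤ t) ∧ n ^ c *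 t < (MonoidAlgebra.lift K (Matrix (Fin d) (Fin d) K) (FreeMonoid (Fin n)) (FreeMonoid.lift M) (Literature.Computability.MetaComplexity.NCIPS.clauseProduct K (φ n))).rank

/-- item stmt-PneNP-18886 · support · rank 5 · closed · proved by Summit.PneNP.PneNP.Theorems.cnfIdealGenLength_fregeShortensGenLength_proof (prover) · by planner
why it might fail: only via an error in LTW Thm 1.4 or in the elementary flattening lemmas; live risks are cost (NC-IPS formula syntax must land in Literature first) and a polarity/ordering mismatch between the tree's CNF→PropForm translation and LTW's tr (audited clean by refuter-rattack-stmt-PneNP-18886-0).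
sources: LiTzameretWang2018, arXiv:1412.8746, arXiv:1910.08503, book:krajicek1995-bounded-arithmetic-propositional-logic-complexity-theory
[crux] for every Frege system F with IsFrege F and F.IsPolyBounded, every polynomial p and every
family of unsatisfiable CNFs φ_n over x_0..x_(n−1) with numClauses, size ≤ p(n): ∃ c, eventually
`HasBoundedRepr ℚ (n^c) (n^c) (φ n)`. Chain: ¬φ_n are DNF tautologies of size poly(n) ⇒ poly-size
F-proofs ⇒ (LTW Thm 1.4) poly-size non-commutative formula IPS certificates over ℚ ⇒
(first-placeholder cut + rank factorisation of the flattening, 2001 results Prop 1.1/Lemma 1.3/Prop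
7.2) ≤ poly single terms of poly degree. Known modulo write-up; a crux because LTW Thm 1.4 needs ≈
300 lines of NC-formula/IPS syntax as a named Literature fact and the flattening half is
unpublished-internal. [difficulty: L] -/
@[route_item "route-PneNP-CnfIdealGenLength"]
def FregeShortensGenLength : Prop :=
  ∀ F : Literature.Computability.MetaComplexity.FregeSystem, Literature.Computability.MetaComplexity.IsFrege F → F.IsPolyBounded → ∀ (p : Polynomial ℕ) (φ : (n : ℕ) → Literature.Computability.Complexity.CNF (Fin n)), (∀ n, ¬ (φ n).Satisfiable ∧ Literature.Computability.Complexity.CNF.numClauses (φ n) ≤ p.eval n ∧ Literature.Computability.Complexity.CNF.size (φ n) ≤ p.eval n) → ∃ c : ℕ, ∀ᶠ n in Filter.atTop, Literature.Computability.MetaComplexity.NCIPS.HasBoundedRepr ℚ (n ^ c) (n ^ c) (φ n)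

-- `FregeShortensGenLength` holds: proved by `Summit.PneNP.PneNP.Theorems.cnfIdealGenLength_fregeShortensGenLength_proof` (its module imports this route file, so no `_holds` link can be stated here).

/-- item stmt-PneNP-18887 · assembly · rank 1 · closed · proved by Summit.PneNP.PneNP.Theorems.cnfIdealGenLength_assembly_proof (prover) · by planner
sources: LiTzameretWang2018, doi:10.1145/3801091
[assembly] GenLengthSuperpoly → FregeShortensGenLength → CollapseReachesFrege → P ≠ NP. -/
@[route_item "route-PneNP-CnfIdealGenLength"]
def Assembly : Prop :=
  GenLengthSuperpoly → FregeShortensGenLength → CollapseReachesFrege → PneNP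

-- `Assembly` holds: proved by `Summit.PneNP.PneNP.Theorems.cnfIdealGenLength_assembly_proof` (its module imports this route file, so no `_holds` link can be stated here).

/-! D-0027 §2.1 — DECIDING THEOREM (planner-authored via `route open/edit --closes-file`; by planner-type-4883f19d1a-0 2026-08-17T18:10:42Z):
its hypotheses are this route's items and its conclusion the sub-problem Statement (glue_lint), and it elaborates with this file. -/

/-- The deciding theorem (D-0027 §2.1), pure filter logic with every binder consumed: if `P = NP`
then the collapse bridge `CollapseReachesFrege` yields a polynomially bounded Frege system `F`;
`FregeShortensGenLength` applied to `F` and to the hard family `φ` of `GenLengthSuperpoly` gives an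
exponent `c` with bounded two-sided representations of the clause products `clauseProduct ℚ (φ n)`
for all large `n`, while `GenLengthSuperpoly` at the same `c` forbids them for all large `n`; the two
eventual statements meet at some `n` (the filter `atTop` on `ℕ` is non-trivial) — contradiction. -/
@[closes "route-PneNP-CnfIdealGenLength"] theorem closes (hGL : GenLengthSuperpoly) (hSh : FregeShortensGenLength) (hC : CollapseReachesFrege) : PneNP := by
  by_contra hS
  obtain ⟨F, hF, hpb⟩ := hC hS
  obtain ⟨p, φ, hgood, hbig⟩ := hGL
  obtain ⟨c, hsmall⟩ := hSh F hF hpb p φ hgood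
  obtain ⟨n, hn⟩ := ((hbig c).and hsmall).exists
  exact hn.1 hn.2

end Summit.PneNP.PneNP.Theses.CnfIdealGenLength
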